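import Summits.BirchSwinnertonDyer.Uniform.U2.RankZeroTwistBSDTwoPlacewise
import Summits.BirchSwinnertonDyer.Uniform.U2.GenusTheoryEndToEndLemma210
import HarnessLib

/-!
# Track U2 (cell `bsd-uniform`, seat u2-p1): `BSD(E, 2) ⟹ BSD(E^{(d)}, 2)` for RANK-ZERO bases on
# `d ≡ 1 (mod 4)` under EXACTLY Mazur–Rubin's Lemma 2.10 at the prime `2`

HONEST FRAMING (cell `bsd-uniform`, HOME run/shared/lean/pub/bsd-uniform/, verbatim in every file of
the seat): a RELATIVE ("twist-transport") theorem, uniform in the twisting parameter `d`, CONDITIONAL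
on NAMED PUBLISHED FACTS taken BY NAME — Zhai 2016 Thm 1.1 / 1.2 AS CORRECTED (`h11` / `h12`),
Mazur–Rubin 2010 Lemma 2.10 place by place (`hMR'`), modularity (`hmod`) — and on PER-BASE binders
of the rank-`0` base `E` ONLY: a globally minimal `Γ₀(N)`-OPTIMAL model with odd Manin constant,
`r_an(E) = 0`, `BSD(E, 2)`, `Ш(E)[2] = 0`, (H-2) `E(ℚ)[2] = 0`, `c(E)` odd; and the ARITHMETIC class
condition on `(E, d)`. THERE IS NO PER-TWIST BINDER. It converts PAIRS `(E, d)` to `BSD(E^{(d)}, 2)`,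
never the class X5 by itself; books nothing; moves no census number; no per-curve certificate is
counted as a uniform theorem — the base's `BSD(E, 2)`
is a per-BASE CERTIFICATE and the twists of a certified rank-`0` base are CERTIFICATE-DERIVED («transport
theorem × base certificate»), with NO per-twist certificate; only the twists of a base whose `BSD₂` is
itself LITERAL (CM / Kriz–Li families) are literal (referee V2 CORRECTION 1; wording of record V97 F97-1,
ERRATUM 2026-08-27: an earlier version of this docstring said «the twists are then LITERAL»).

THIS FILE = `RankZeroTwistBSDTwoPlacewise.lean` (`bsdp_two_twist_of_rankZero_base_placewise`) with the
`2`-adic class condition WIDENED to Mazur–Rubin's full Lemma 2.10 list at `2` for `d ≡ 1 (mod 4)`: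
(i) `d ≡ 1 (mod 8)`, (v) good reduction at `2`, (iii) MULTIPLICATIVE reduction at `2` with `ord₂(Δ)`
odd — the new case served on the Tamagawa side by `TwistTamagawaTwoAdicSemistable.lean` (the
unramified twist of a multiplicative fibre is multiplicative, `2` included). What remains at `2`
(HOME/RESIDUE.md R-A3′ as worded): bases additive at `2` or multiplicative with even `ord₂ Δ` need
`d ≡ 1 (mod 8)`.

## Contents (theorems only; no `def`, no named fact)
* **`bsdp_two_twist_of_rankZero_base_lemma210`**.

References: Zhai 2016 [Zhai2016]; Mazur–Rubin 2010 Lemma 2.10 [MazurRubin2010]; Silverman *ATAEC*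
IV.9, IV.10.2 [SilvermanATAEC1994]; Silverman AEC VII.1, VII.5 [SilvermanAEC2009]; Miller 2011 Def.
1.1 [Miller2011LMS].
-/

noncomputable section

open scoped Classical AddSubgroup

open NumberField WeierstrassCurve Literature.NumberTheory.EllipticCurves
  Literature.NumberTheory.EllipticCurves.ModularForms
  Literature.NumberTheory.EllipticCurves.Rank1Residual
  Literature.NumberTheory.EllipticCurves.Zhai2016
  Summit.BirchSwinnertonDyer.Rank1Residual

namespace Summit.BirchSwinnertonDyer.Uniform.U2

/-- **`BSD(E, 2) ⟹ BSD(E^{(d)}, 2)` UNIFORMLY ON THE `a_q`-ODD CLASS, `d ≡ 1 (mod 4)`, Lemma 2.10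
(i)/(v)/(iii) at `2` — rank-`0` optimal bases, no per-twist binder.** As
`bsdp_two_twist_of_rankZero_base_placewise` with `h2` WIDENED to «`d ≡ 1 (mod 8)` ∨ `E` good at `2` ∨
(`E` multiplicative at `2` with `ord₂(Δ)` odd)»; every other binder byte-identical. Conclusion for
every globally minimal model `WM` of `E^{(d)}`: `r_an = 0`, rank `0`, `Ш[2^∞] = 0`, `∏ c_ℓ` odd,
`BSD(E^{(d)}, 2)`. [cite: Zhai2016, Thm. 1.1 and Thm. 1.2 (arXiv:1409.0231v2 Thm. 1.1 / 1.3)]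
[cite: MazurRubin2010, Lemma 2.10 (i)–(v) with Def. 2.3, proof of Prop. 3.3 (T = ∅), and Prop. 4.2]
[cite: SilvermanATAEC1994, Cor. IV.9.2(d), IV.9.4 Step 2 and IV.10.2(b)] [cite: Miller2011LMS, Def. 1.1] -/
theorem bsdp_two_twist_of_rankZero_base_lemma210
    -- named published facts
    (h11 : thm11_ordTwo_LAlg_twist_eq_zero') (h12 : thm12_ordTwo_LAlg_twist_eq_one')
    (hMR' : MazurRubin2010.d2_eq_of_lemma210_rat) (hmod : exists_isNewformOf)
    -- the base `E` (rank `0`, optimal, odd Manin constant) and a globally minimal model of `E^{(d)}`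
    (W WM : WeierstrassCurve ℚ) [W.IsElliptic] [W.IsGloballyMinimal] [NeZero (W.conductorNorm ℤ)]
    [WM.IsElliptic] [WM.IsGloballyMinimal]
    (Dt : ModularParametrizationData W (W.conductorNorm ℤ)) (hopt : Zhai2021.IsOptimalDatum W Dt)
    (hν : ¬ (2 : ℤ) ∣ Dt.c)
    -- PER BASE
    (hr : W.analyticRank = 0) (hbsd : BSDp W 2)
    (hSha : ∀ x : W.galH1, x ∈ W.sha → 2 • x = 0 → x = 0)
    (hT : ∀ P : W.toAffine.Point, 2 • P = 0 → P = 0) (hc : Odd W.tamagawaProduct)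
    -- the class condition on `(E, d)`: `d ≡ 1 (mod 4)`; at `2`: Mazur–Rubin Lemma 2.10 (i)/(v)/(iii)
    {d : ℤ} (hsqf : Squarefree d) (hd1 : d ≠ 1) (hd4 : d % 4 = 1)
    (h2 : d % 8 = 1 ∨ W.HasGoodReductionAtPrime 2 ∨
      (W.HasMultiplicativeReductionAtPrime 2 ∧ Odd (padicValRat 2 W.Δ)))
    (hgcd : Int.gcd d (W.conductorNorm ℤ) = 1)
    (hS : ∀ (q : ℕ), q.Prime → (q : ℤ) ∣ d →
      ¬ (q : ℤ) ∣ minimalDiscriminantInt W ∧ Odd (W.frobeniusTrace q))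
    (hadd : ∀ (p : ℕ) [Fact p.Prime], ¬ W.HasGoodReductionAtPrime p →
      ¬ W.HasMultiplicativeReductionAtPrime p → p ≠ 2 → jacobiSym d p = 1)
    (hmev : ∀ (p : ℕ) [Fact p.Prime], W.HasMultiplicativeReductionAtPrime p →
      Even (padicValRat p W.Δ) → p ≠ 2 → jacobiSym d p = 1)
    (hreal : 0 < W.Δ → 0 < d)
    (hM : ∃ C : VariableChange ℚ, C • WM = W.quadraticTwist (d : ℚ)) :
    WM.analyticRank = 0 ∧ WM.mordellWeilRank = 0 ∧ AddCommGroup.primaryComponent WM.sha 2 = ⊥ ∧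
      Odd WM.tamagawaProduct ∧ BSDp WM 2 := by
  haveI : Fact (Nat.Prime 2) := ⟨Nat.prime_two⟩
  -- ANALYTIC side: Zhai 1.1' / 1.2' (`d ≡ 1 (mod 4)` suffices)
  obtain ⟨hr', hrk, hReg, ⟨q, hq, hq0, hvq⟩, hfin⟩ := rankZero_twist_of_zhai' h11 h12
    (WeierstrassCurve.hasEntireLFunction_rat_of_exists_isNewformOf hmod) W WM Dt hopt hν hr hbsd hSha
    hT hc hsqf hd4 hd1 hgcd hS hreal hM
  -- ALGEBRAIC side: route A place-wise — `#Sel₂(E^{(d)}) = #Sel₂(E) = 1`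
  have hctrl := natCard_selmerGroup_twist_eq_of_lemma210 W hMR' hsqf hd1 hd4 h2 hS hadd hmev hreal WM hM
  have hW : Nat.card (W.selmerGroup 2) = 1 :=
    natCard_selmerGroup_two_eq_one_of_rank_zero W (hbsd.1.trans hr) hT hSha
  obtain ⟨-, hM2, hshaM⟩ :=
    rank_eq_zero_and_sha_two_eq_bot_of_card_selmerGroup_two_eq_one WM (hctrl.trans hW)
  -- LOCAL side: `ord₂ ∏ c(E^{(d)}) = ord₂ ∏ c(E) = 0` (Lemma 2.10 (i)/(v)/(iii) at `2`)
  have hcv := padicValNat_two_tamagawaProduct_twist_eq_of_lemma210 W hd4 h2 hS hadd hmev hM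
  have hc0 : padicValNat 2 W.tamagawaProduct = 0 :=
    padicValNat.eq_zero_of_not_dvd (Nat.two_dvd_ne_zero.mpr (Nat.odd_iff.mp hc))
  have hcM0 : padicValNat 2 WM.tamagawaProduct = 0 := hcv.trans hc0
  have hcM : Odd WM.tamagawaProduct := by
    have h := hcM0
    rw [padicValNat.eq_zero_iff] at h
    rcases h with h | h | h
    · norm_num at h
    · exact absurd h WM.tamagawaProduct_pos_holds.ne'
    · exact Nat.odd_iff.mpr (Nat.two_dvd_ne_zero.mp h)
  -- odd torsion of the twist
  have h1M : Nat.card {P : WM.toAffine.Point // (2 : ℕ) • P = 0} = 1 :=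
    natCard_twoTorsionSubtype_eq_one_of_torsionBy_eq_bot hM2
  have htorM : padicValNat 2 WM.torsionOrder = 0 :=
    padicValNat_torsionOrder_eq_zero_of_irreducible WM 2 (P2.irr_two_of_card_twoTorsion_eq_one WM h1M)
  -- bookkeeping: `#Ш_an(E^{(d)}) = q T² / c`, of `2`-adic valuation `0 = ord₂ #Ш[2^∞]`
  have hTpos : (0 : ℕ) < WM.torsionOrder := WM.torsionOrder_pos_holds
  have hcpos : 0 < WM.tamagawaProduct := WM.tamagawaProduct_pos'
  have hΩ : (WM.realPeriodRat : ℂ) ≠ 0 := by exact_mod_cast WM.realPeriodRat_pos_holds.ne'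
  have hTq : (WM.torsionOrder : ℚ) ≠ 0 := by exact_mod_cast hTpos.ne'
  have hcq : (WM.tamagawaProduct : ℚ) ≠ 0 := by exact_mod_cast hcpos.ne'
  refine ⟨hr', hrk, hshaM, hcM, hrk.trans hr'.symm, finite_primaryComponent_sha_of_finite WM hfin,
    q * (WM.torsionOrder : ℚ) ^ 2 / (WM.tamagawaProduct : ℚ), ?_, ?_⟩
  · rw [shaAn_def, hq, hReg]
    push_cast
    field_simp
  · rw [hshaM, AddSubgroup.card_bot, padicValNat_one_right,
      padicValRat.div (mul_ne_zero hq0 (pow_ne_zero 2 hTq)) hcq,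
      padicValRat.mul hq0 (pow_ne_zero 2 hTq), padicValRat.pow, padicValRat.of_nat,
      padicValRat.of_nat, hvq, htorM, hcM0]
    simp

end Summit.BirchSwinnertonDyer.Uniform.U2

end
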